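import Summits.SmoothPoincare4.SmoothPoincare4.Theses.SymplecticOrigami
import Literature.Analysis.Calculus.SlopeQuotient

/-!
# Stub `stub_ballFunction` of line `pair-rigidity-endgame`, part 1: model-space calculus

Elementary calculus in normed spaces used by the construction of the ball function
(`SymplecticOrigamiOrigamiRungStubBallFunction.lean`):

* `exists_contDiff_eqOn_ball` — smooth cut-off of a map that is smooth on an open set;
* `exists_eq_snd_smul` — Hadamard's lemma in the last variable, local form: a smooth map
  `g : E × ℝ → G` vanishing on the slice `{s = 0}` near `(a₀, 0)` is `g (a, s) = s • h (a, s)` near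
  `(a₀, 0)` with `h` smooth and `h (a₀, 0) = ∂ₛ g (a₀, 0)` (via the tree's `slopeQuot`);
* `exists_signedNorm_model` — if moreover `G` is an inner product space and `∂ₛ g (a₀, 0) ≠ 0`, the
  *signed norm* `τ (a, s) = s ‖h (a, s)‖ = sign (s) ‖g (a, s)‖` is smooth near `(a₀, 0)` with
  `∂ₛ τ ≠ 0` on the slice, and `g ≠ 0` off the slice;
* the two profiles `u ↦ -(√(1 + u))⁻¹` and `ρ s = -s (√(1 + s²))⁻¹` and their derivatives, the first
  and second derivative of `y ↦ -(√(1 + ‖Φ y‖²))⁻¹` at a zero of `Φ`;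
* `comp_ne_zero_of_finrank_ker` — rank count: `L₂ ∘ L₁ ≠ 0` when
  `dim ker L₁ + dim ker L₂ < dim (source)`;
* `stub_ballFunction_signedNormModel` — universe-monomorphic export of `exists_signedNorm_model`
  with explicit binders (the registered sub-goal of this file).

Everything is folklore calculus and linear algebra.
-/

noncomputable section

-- the prescribed namespace `Summit.<P>.<Sub>.…` duplicates `SmoothPoincare4` (P = Sub)
set_option linter.dupNamespace false

open scoped Manifold ContDiff Topology ContinuousMap RealInnerProductSpace
open Set TopologicalSpace
open Literature.Topology.FourManifolds (singularHomologyZ sphereInversion IsTwistedSphere)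
open Literature.Geometry.Kaehler (MForm IsSmoothForm IsClosedForm)

namespace Summit.SmoothPoincare4.SmoothPoincare4.Theorems.OrigamiRung.PairRigidityEndgame

/-! ### Smooth cut-off -/

section Cutoff

variable {F : Type*} [NormedAddCommGroup F] [NormedSpace ℝ F] [HasContDiffBump F]
  {G : Type*} [NormedAddCommGroup G] [NormedSpace ℝ G]

/-- **Smooth cut-off.** A map which is `C^m` on an open set `U ∋ y₀` agrees on a ball around `y₀`
contained in `U` with a globally `C^m` map (multiply by a bump function supported in `U`).
[folklore] -/
theorem exists_contDiff_eqOn_ball {g : F → G} {U : Set F} (hU : IsOpen U) {y₀ : F} (hy₀ : y₀ ∈ U)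
    {m : ℕ∞} (hg : ContDiffOn ℝ m g U) :
    ∃ g' : F → G, ContDiff ℝ m g' ∧ ∃ r > (0 : ℝ), Metric.ball y₀ r ⊆ U ∧
      ∀ y ∈ Metric.ball y₀ r, g' y = g y := by
  obtain ⟨r, hr, hrU⟩ := Metric.isOpen_iff.1 hU y₀ hy₀
  let ρ : ContDiffBump y₀ := ⟨r / 4, r / 2, by positivity, by linarith⟩
  refine ⟨fun y => ρ y • g y, ?_, r / 4, by positivity,
    (Metric.ball_subset_ball (by linarith)).trans hrU, fun y hy => ?_⟩
  · rw [contDiff_iff_contDiffAt]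
    intro y
    by_cases hyU : y ∈ U
    · exact ρ.contDiff.contDiffAt.smul (hg.contDiffAt (hU.mem_nhds hyU))
    · have hy' : y ∉ tsupport ρ := by
        rw [ρ.tsupport_eq]
        intro h'
        refine hyU (hrU ?_)
        have : dist y y₀ ≤ r / 2 := Metric.mem_closedBall.1 h'
        exact Metric.mem_ball.2 (by linarith)
      have h0 : (fun y => ρ y • g y) =ᶠ[𝓝 y] fun _ => 0 := by
        filter_upwards [notMem_tsupport_iff_eventuallyEq.1 hy'] with z hz
        simp [hz]
      exact contDiffAt_const.congr_of_eventuallyEq h0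
  · have hy1 : y ∈ Metric.closedBall y₀ ρ.rIn := Metric.ball_subset_closedBall hy
    show ρ y • g y = g y
    rw [ρ.one_of_mem_closedBall hy1, one_smul]

end Cutoff

/-! ### Hadamard's lemma in the last variable and the signed norm -/

section Hadamard

variable {E : Type*} [NormedAddCommGroup E] {G : Type*} [NormedAddCommGroup G]

/-- In the product metric, the foot `(a, 0)` of a point `(a, s)` of a ball centred on the slice
`{s = 0}` lies in the same ball. [folklore] -/
theorem fst_zero_mem_ball {a₀ : E} {r : ℝ} {q : E × ℝ} (hq : q ∈ Metric.ball (a₀, (0 : ℝ)) r) :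
    (q.1, (0 : ℝ)) ∈ Metric.ball (a₀, (0 : ℝ)) r := by
  rw [Metric.mem_ball, Prod.dist_eq] at hq ⊢
  rw [dist_self]
  exact max_lt (lt_of_le_of_lt (le_max_left _ _) hq) (lt_of_le_of_lt dist_nonneg
    (lt_of_le_of_lt (le_max_left _ _) hq))

/-- `‖s • w‖ = |s| ‖w‖` read with signs: `0 ≤ s` gives `s ‖w‖ = ‖s • w‖`. [folklore] -/
theorem snd_mul_norm_eq_of_nonneg [NormedSpace ℝ G] {s : ℝ} (hs : 0 ≤ s) (w : G) :
    s * ‖w‖ = ‖s • w‖ := by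
  rw [norm_smul, Real.norm_eq_abs, abs_of_nonneg hs]

/-- `‖s • w‖ = |s| ‖w‖` read with signs: `s ≤ 0` gives `s ‖w‖ = -‖s • w‖`. [folklore] -/
theorem snd_mul_norm_eq_of_nonpos [NormedSpace ℝ G] {s : ℝ} (hs : s ≤ 0) (w : G) :
    s * ‖w‖ = -‖s • w‖ := by
  rw [norm_smul, Real.norm_eq_abs, abs_of_nonpos hs]
  ring

variable [NormedSpace ℝ E] [FiniteDimensional ℝ E] [NormedSpace ℝ G] [CompleteSpace G]

/-- **Hadamard's lemma in the last variable (local form).** A map `g : E × ℝ → G`, smooth on an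
open set `U ∋ (a₀, 0)` and vanishing on the slice `{s = 0} ∩ U`, factors on a ball around
`(a₀, 0)` as `g (a, s) = s • h (a, s)` with `h` smooth and `h (a₀, 0) = ∂ₛ g (a₀, 0)`: cut `g` off
to a globally smooth map and take `h = ∫₀¹ ∂ₛ g (a, u s) du` (`slopeQuot`).
[cite: Milnor1963, Lemma 2.1] -/
theorem exists_eq_snd_smul {g : E × ℝ → G} {U : Set (E × ℝ)} (hU : IsOpen U) {a₀ : E}
    (ha₀ : (a₀, (0 : ℝ)) ∈ U) (hg : ContDiffOn ℝ ∞ g U)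
    (h0 : ∀ a : E, (a, (0 : ℝ)) ∈ U → g (a, 0) = 0) :
    ∃ (h : E × ℝ → G) (r : ℝ), 0 < r ∧ ContDiff ℝ ∞ h ∧ Metric.ball (a₀, (0 : ℝ)) r ⊆ U ∧
      (∀ q ∈ Metric.ball (a₀, (0 : ℝ)) r, g q = q.2 • h q) ∧
      h (a₀, 0) = fderiv ℝ g (a₀, 0) (0, 1) := by
  obtain ⟨g', hg', r, hr, hrU, hgg'⟩ := exists_contDiff_eqOn_ball hU ha₀ hg
  refine ⟨Literature.Analysis.Calculus.slopeQuot g', r, hr,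
    Literature.Analysis.Calculus.contDiff_slopeQuot_infty hg', hrU, fun q hq => ?_, ?_⟩
  · have h1 := Literature.Analysis.Calculus.eq_add_smul_slopeQuot hg' (by simp) q.1 q.2
    have h2 : g' (q.1, 0) = 0 := by
      rw [hgg' _ (fst_zero_mem_ball hq)]
      exact h0 _ (hrU (fst_zero_mem_ball hq))
    rw [h2, zero_add, Prod.mk.eta, hgg' q hq] at h1
    exact h1
  · rw [Literature.Analysis.Calculus.slopeQuot_zero]
    have heq : g' =ᶠ[𝓝 (a₀, (0 : ℝ))] g :=
      Filter.eventuallyEq_of_mem (Metric.isOpen_ball.mem_nhds (Metric.mem_ball_self hr)) hgg'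
    rw [heq.fderiv_eq]

end Hadamard

section SignedNorm

variable {E : Type*} [NormedAddCommGroup E] [NormedSpace ℝ E] [FiniteDimensional ℝ E]
  {G : Type*} [NormedAddCommGroup G] [InnerProductSpace ℝ G] [CompleteSpace G]

/-- **The signed norm across a slice (model form).** Let `g : E × ℝ → G` (values in a real inner
product space) be smooth on an open `U ∋ (a₀, 0)`, vanish on the slice `{s = 0} ∩ U`, and have
`∂ₛ g (a₀, 0) ≠ 0`. Then on a ball around `(a₀, 0)` inside `U` the function
`τ = sign (s) · ‖g‖` (`= s ‖h‖` for the Hadamard quotient `h`, which does not vanish there) is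
smooth, `∂ₛ τ ≠ 0` on the slice, and `g ≠ 0` off the slice. [folklore] -/
theorem exists_signedNorm_model {g : E × ℝ → G} {U : Set (E × ℝ)} (hU : IsOpen U) {a₀ : E}
    (ha₀ : (a₀, (0 : ℝ)) ∈ U) (hg : ContDiffOn ℝ ∞ g U)
    (h0 : ∀ a : E, (a, (0 : ℝ)) ∈ U → g (a, 0) = 0) (hd : fderiv ℝ g (a₀, 0) (0, 1) ≠ 0) :
    ∃ (τ : E × ℝ → ℝ) (r : ℝ), 0 < r ∧ Metric.ball (a₀, (0 : ℝ)) r ⊆ U ∧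
      ContDiffOn ℝ ∞ τ (Metric.ball (a₀, (0 : ℝ)) r) ∧
      (∀ q ∈ Metric.ball (a₀, (0 : ℝ)) r, 0 ≤ q.2 → τ q = ‖g q‖) ∧
      (∀ q ∈ Metric.ball (a₀, (0 : ℝ)) r, q.2 ≤ 0 → τ q = -‖g q‖) ∧
      (∀ q ∈ Metric.ball (a₀, (0 : ℝ)) r, q.2 ≠ 0 → g q ≠ 0) ∧
      (∀ q ∈ Metric.ball (a₀, (0 : ℝ)) r, q.2 = 0 → fderiv ℝ τ q (0, 1) ≠ 0) := by
  obtain ⟨h, r₁, hr₁, hh, hrU, hgh, hh₀⟩ := exists_eq_snd_smul hU ha₀ hg h0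
  have hne₀ : h (a₀, 0) ≠ 0 := by rwa [hh₀]
  obtain ⟨r₂, hr₂, hne⟩ : ∃ r₂ > (0 : ℝ), ∀ q ∈ Metric.ball (a₀, (0 : ℝ)) r₂, h q ≠ 0 := by
    have hev : ∀ᶠ q in 𝓝 (a₀, (0 : ℝ)), h q ≠ 0 :=
      (hh.continuous.continuousAt (x := (a₀, (0 : ℝ)))).eventually_ne hne₀
    exact Metric.eventually_nhds_iff_ball.1 hev
  set r := min r₁ r₂ with hr
  have hb₁ : Metric.ball (a₀, (0 : ℝ)) r ⊆ Metric.ball (a₀, 0) r₁ :=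
    Metric.ball_subset_ball (min_le_left _ _)
  have hb₂ : Metric.ball (a₀, (0 : ℝ)) r ⊆ Metric.ball (a₀, 0) r₂ :=
    Metric.ball_subset_ball (min_le_right _ _)
  refine ⟨fun q => q.2 * ‖h q‖, r, lt_min hr₁ hr₂, hb₁.trans hrU, fun q hq => ?_,
    fun q hq hq2 => ?_, fun q hq hq2 => ?_, fun q hq hq2 => ?_, fun q hq hq2 => ?_⟩
  · exact (contDiffAt_snd.mul (hh.contDiffAt.norm ℝ (hne q (hb₂ hq)))).contDiffWithinAt
  · rw [hgh q (hb₁ hq)]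
    exact snd_mul_norm_eq_of_nonneg hq2 _
  · rw [hgh q (hb₁ hq)]
    exact snd_mul_norm_eq_of_nonpos hq2 _
  · rw [hgh q (hb₁ hq)]
    exact smul_ne_zero hq2 (hne q (hb₂ hq))
  · have h1 : HasFDerivAt (fun q : E × ℝ => q.2) (ContinuousLinearMap.snd ℝ E ℝ) q :=
      hasFDerivAt_snd
    have h2 : HasFDerivAt (fun q : E × ℝ => ‖h q‖) (fderiv ℝ (fun q : E × ℝ => ‖h q‖) q) q :=
      ((hh.contDiffAt.norm ℝ (hne q (hb₂ hq))).differentiableAt (by simp)).hasFDerivAt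
    have h3 : HasFDerivAt (fun q : E × ℝ => q.2 * ‖h q‖)
        (q.2 • fderiv ℝ (fun q : E × ℝ => ‖h q‖) q + ‖h q‖ • ContinuousLinearMap.snd ℝ E ℝ) q :=
      h1.mul h2
    rw [h3.fderiv, hq2]
    simp only [zero_smul, zero_add, FunLike.coe_smul, Pi.smul_apply,
      ContinuousLinearMap.coe_snd', smul_eq_mul, mul_one, ne_eq, norm_eq_zero]
    exact hne q (hb₂ hq)

end SignedNorm

/-! ### The two profiles -/

section Profiles

/-- Derivative of the even profile `u ↦ -(√(1 + u))⁻¹` (`u > -1`):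
`(2 (1 + u) √(1 + u))⁻¹ > 0`. [folklore] -/
theorem hasDerivAt_negInvSqrt {u : ℝ} (hu : -1 < u) :
    HasDerivAt (fun u : ℝ => -(√(1 + u))⁻¹) (2 * ((1 + u) * √(1 + u)))⁻¹ u := by
  have hpos : 0 < 1 + u := by linarith
  have hw : 0 < √(1 + u) := Real.sqrt_pos.2 hpos
  have h1 : HasDerivAt (fun u : ℝ => 1 + u) 1 u := (hasDerivAt_id' u).const_add 1
  have h3 : HasDerivAt (fun u : ℝ => -(√(1 + u))⁻¹) (-(-(1 / (2 * √(1 + u))) / √(1 + u) ^ 2)) u :=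
    ((h1.sqrt hpos.ne').inv hw.ne').neg
  convert h3 using 1
  rw [Real.sq_sqrt hpos.le]
  field_simp

/-- The derivative `u ↦ (2 (1 + u) √(1 + u))⁻¹` of the even profile is differentiable at every
`u > -1`. [folklore] -/
theorem differentiableAt_deriv_negInvSqrt {u : ℝ} (hu : -1 < u) :
    DifferentiableAt ℝ (fun u : ℝ => (2 * ((1 + u) * √(1 + u)))⁻¹) u := by
  have hpos : 0 < 1 + u := by linarith
  have hw : 0 < √(1 + u) := Real.sqrt_pos.2 hpos
  have h1 : DifferentiableAt ℝ (fun u : ℝ => 1 + u) u := differentiableAt_id.const_add 1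
  exact ((h1.mul (h1.sqrt hpos.ne')).const_mul 2).inv
    (mul_ne_zero two_ne_zero (mul_ne_zero hpos.ne' hw.ne'))

/-- The derivative of the even profile is positive. [folklore] -/
theorem deriv_negInvSqrt_pos {u : ℝ} (hu : -1 < u) : 0 < (2 * ((1 + u) * √(1 + u)))⁻¹ := by
  have hpos : 0 < 1 + u := by linarith
  have hw : 0 < √(1 + u) := Real.sqrt_pos.2 hpos
  exact inv_pos.2 (mul_pos two_pos (mul_pos hpos hw))

variable {V : Type*} [NormedAddCommGroup V] [InnerProductSpace ℝ V]

/-- The ball profile `y ↦ -(√(1 + ‖y‖²))⁻¹` is smooth on a real inner product space. [folklore] -/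
theorem contDiff_ballProfile : ContDiff ℝ ∞ fun y : V => -(√(1 + ‖y‖ ^ 2))⁻¹ := by
  have h1 : ContDiff ℝ ∞ fun y : V => 1 + ‖y‖ ^ 2 := contDiff_const.add (contDiff_norm_sq ℝ)
  have hpos : ∀ y : V, (0 : ℝ) < 1 + ‖y‖ ^ 2 := fun y => by positivity
  exact ((h1.sqrt fun y => (hpos y).ne').inv fun y => (Real.sqrt_pos.2 (hpos y)).ne').neg

/-- The odd profile `ρ s = -s (√(1 + s²))⁻¹` is smooth. [folklore] -/
theorem contDiff_oddProfile : ContDiff ℝ ∞ fun s : ℝ => -s * (√(1 + s ^ 2))⁻¹ := by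
  have h1 : ContDiff ℝ ∞ fun s : ℝ => 1 + s ^ 2 := contDiff_const.add (contDiff_id.pow 2)
  have hpos : ∀ s : ℝ, (0 : ℝ) < 1 + s ^ 2 := fun s => by positivity
  exact contDiff_neg.mul ((h1.sqrt fun s => (hpos s).ne').inv fun s =>
    (Real.sqrt_pos.2 (hpos s)).ne')

/-- Derivative of the odd profile: `ρ' s = -((1 + s²) √(1 + s²))⁻¹`. [folklore] -/
theorem hasDerivAt_oddProfile (s : ℝ) :
    HasDerivAt (fun s : ℝ => -s * (√(1 + s ^ 2))⁻¹) (-((1 + s ^ 2) * √(1 + s ^ 2))⁻¹) s := by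
  have hpos : (0 : ℝ) < 1 + s ^ 2 := by positivity
  have hw : 0 < √(1 + s ^ 2) := Real.sqrt_pos.2 hpos
  have h1 : HasDerivAt (fun s : ℝ => 1 + s ^ 2) (2 * s) s := by
    simpa using (hasDerivAt_pow 2 s).const_add 1
  have h2 := (h1.sqrt hpos.ne').inv hw.ne'
  have h3 : HasDerivAt (fun s : ℝ => -s * (√(1 + s ^ 2))⁻¹)
      (-1 * (√(1 + s ^ 2))⁻¹ + -s * (-(2 * s / (2 * √(1 + s ^ 2))) / √(1 + s ^ 2) ^ 2)) s :=
    (hasDerivAt_id' s).neg.mul h2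
  convert h3 using 1
  have hw2 : √(1 + s ^ 2) ^ 2 = 1 + s ^ 2 := Real.sq_sqrt hpos.le
  field_simp
  rw [hw2]
  ring

/-- The derivative of the odd profile never vanishes. [folklore] -/
theorem deriv_oddProfile_ne_zero (s : ℝ) : -((1 + s ^ 2) * √(1 + s ^ 2))⁻¹ ≠ 0 := by
  have hpos : (0 : ℝ) < 1 + s ^ 2 := by positivity
  have hw : 0 < √(1 + s ^ 2) := Real.sqrt_pos.2 hpos
  have : 0 < ((1 + s ^ 2) * √(1 + s ^ 2))⁻¹ := by positivity
  linarith

/-- The two profiles match under inversion: `ρ (r⁻¹) = -(√(1 + r²))⁻¹` for `r > 0`. [folklore] -/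
theorem oddProfile_inv {r : ℝ} (hr : 0 < r) :
    -r⁻¹ * (√(1 + r⁻¹ ^ 2))⁻¹ = -(√(1 + r ^ 2))⁻¹ := by
  have h1 : r * √(1 + r⁻¹ ^ 2) = √(1 + r ^ 2) := by
    rw [← Real.sqrt_sq hr.le, ← Real.sqrt_mul (sq_nonneg r), Real.sqrt_sq hr.le]
    congr 1
    field_simp
    ring
  rw [← h1, mul_inv, neg_mul]

/-- The odd profile at `-s` is `s (√(1 + s²))⁻¹`. [folklore] -/
theorem oddProfile_neg (s : ℝ) : -(-s) * (√(1 + (-s) ^ 2))⁻¹ = s * (√(1 + s ^ 2))⁻¹ := by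
  rw [neg_neg, neg_sq]

/-! ### First and second derivative of the ball profile along a map -/

variable {E : Type*} [NormedAddCommGroup E] [NormedSpace ℝ E]

/-- Chain rule: the derivative of `y ↦ -(√(1 + ‖Φ y‖²))⁻¹` is
`(2 (1 + ‖Φ y‖²) √(1 + ‖Φ y‖²))⁻¹ • (2 ⟪Φ y, ·⟫ ∘ DΦ)`. [folklore] -/
theorem hasFDerivAt_ballProfile_comp {Φ : E → V} {Φ' : E →L[ℝ] V} {y : E}
    (hΦ : HasFDerivAt Φ Φ' y) :
    HasFDerivAt (fun y => -(√(1 + ‖Φ y‖ ^ 2))⁻¹)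
      ((2 * ((1 + ‖Φ y‖ ^ 2) * √(1 + ‖Φ y‖ ^ 2)))⁻¹ • ((2 • innerSL ℝ (Φ y)).comp Φ')) y := by
  have hu : (-1 : ℝ) < ‖Φ y‖ ^ 2 := lt_of_lt_of_le (by norm_num) (sq_nonneg _)
  have h := (hasDerivAt_negInvSqrt hu).comp_hasFDerivAt y hΦ.norm_sq
  exact h

/-- At a point where `DΦ` is onto, a critical point of `y ↦ -(√(1 + ‖Φ y‖²))⁻¹` is a zero of
`Φ`. [folklore] -/
theorem eq_zero_of_fderiv_ballProfile_comp_eq_zero {Φ : E → V} {Φ' : E →L[ℝ] V} {y : E}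
    (hΦ : HasFDerivAt Φ Φ' y) (hsurj : Function.Surjective Φ')
    (h0 : fderiv ℝ (fun y => -(√(1 + ‖Φ y‖ ^ 2))⁻¹) y = 0) : Φ y = 0 := by
  rw [(hasFDerivAt_ballProfile_comp hΦ).fderiv] at h0
  obtain ⟨v, hv⟩ := hsurj (Φ y)
  have h1 := congrArg (fun L : E →L[ℝ] ℝ => L v) h0
  have hu : (-1 : ℝ) < ‖Φ y‖ ^ 2 := lt_of_lt_of_le (by norm_num) (sq_nonneg _)
  have hc := (deriv_negInvSqrt_pos hu).ne'
  simp only [FunLike.coe_smul, Pi.smul_apply, ContinuousLinearMap.comp_apply, hv,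
    FunLike.coe_zero, Pi.zero_apply, smul_eq_mul, mul_eq_zero, hc, false_or] at h1
  simpa [innerSL_apply_apply] using h1

/-- **Second derivative of the ball profile at a zero.** If `Φ` is differentiable near `e₀` with
derivative `Φ'`, `Φ'` is differentiable at `e₀` and `Φ e₀ = 0`, then
`D² (-(√(1 + ‖Φ‖²))⁻¹) (e₀) (u, v) = ⟪Φ' e₀ u, Φ' e₀ v⟫`. [folklore] -/
theorem fderiv_fderiv_ballProfile_comp {Φ : E → V} {Φ' : E → E →L[ℝ] V}
    {Φ'' : E →L[ℝ] E →L[ℝ] V} {e₀ : E} (hΦ : ∀ᶠ y in 𝓝 e₀, HasFDerivAt Φ (Φ' y) y)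
    (hΦ' : HasFDerivAt Φ' Φ'' e₀) (h0 : Φ e₀ = 0) (u v : E) :
    fderiv ℝ (fderiv ℝ fun y => -(√(1 + ‖Φ y‖ ^ 2))⁻¹) e₀ u v = ⟪Φ' e₀ u, Φ' e₀ v⟫ := by
  -- the first derivative near `e₀`
  set c : E → ℝ := fun y => (2 * ((1 + ‖Φ y‖ ^ 2) * √(1 + ‖Φ y‖ ^ 2)))⁻¹ with hc
  set B : E → E →L[ℝ] ℝ := fun y => (2 • innerSL ℝ (Φ y)).comp (Φ' y) with hB
  have h1 : fderiv ℝ (fun y => -(√(1 + ‖Φ y‖ ^ 2))⁻¹) =ᶠ[𝓝 e₀] fun y => c y • B y := by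
    filter_upwards [hΦ] with y hy
    exact (hasFDerivAt_ballProfile_comp hy).fderiv
  rw [h1.fderiv_eq]
  -- differentiate the product `c • B` at `e₀`, where `B e₀ = 0`
  have hΦ₀ : HasFDerivAt Φ (Φ' e₀) e₀ := hΦ.self_of_nhds
  have hcd : DifferentiableAt ℝ c e₀ := by
    have hu : (-1 : ℝ) < ‖Φ e₀‖ ^ 2 := lt_of_lt_of_le (by norm_num) (sq_nonneg _)
    have h2 : DifferentiableAt ℝ (fun y => ‖Φ y‖ ^ 2) e₀ := hΦ₀.norm_sq.differentiableAt
    have h3 := (differentiableAt_deriv_negInvSqrt hu).comp e₀ h2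
    exact h3
  have hI : HasFDerivAt (fun y => 2 • innerSL ℝ (Φ y))
      (2 • (innerSL ℝ (E := V) : V →L[ℝ] V →L[ℝ] ℝ).comp (Φ' e₀)) e₀ :=
    ((innerSL ℝ (E := V) : V →L[ℝ] V →L[ℝ] ℝ).hasFDerivAt.comp e₀ hΦ₀).const_smul 2
  have hBd : HasFDerivAt B _ e₀ := hI.clm_comp hΦ'
  have hprod : HasFDerivAt (fun y => c y • B y) _ e₀ := hcd.hasFDerivAt.smul hBd
  rw [hprod.fderiv]
  have hB₀ : B e₀ = 0 := by
    ext w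
    simp [hB, h0]
  have hc₀ : c e₀ = 2⁻¹ := by simp [hc, h0]
  have hΦe : innerSL ℝ (Φ e₀) = 0 := by rw [h0, map_zero]
  simp only [hB₀, ContinuousLinearMap.smulRight_zero, add_zero, FunLike.coe_smul,
    Pi.smul_apply, add_apply, ContinuousLinearMap.comp_apply, hc₀,
    ContinuousLinearMap.compL_apply, ContinuousLinearMap.flip_apply, hΦe]
  simp [innerSL_apply_apply, two_smul]
  ring

end Profiles

/-! ### Rank count -/

section LinearAlgebra

variable {V₁ V₂ V₃ : Type*} [AddCommGroup V₁] [Module ℝ V₁] [AddCommGroup V₂] [Module ℝ V₂]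
  [AddCommGroup V₃] [Module ℝ V₃] [FiniteDimensional ℝ V₁] [FiniteDimensional ℝ V₂]

/-- **Rank count.** If `dim ker L₁ + dim ker L₂ < dim V₁` then `L₂ ∘ L₁ ≠ 0` (otherwise
`range L₁ ≤ ker L₂` and rank–nullity gives `dim V₁ ≤ dim ker L₁ + dim ker L₂`). [folklore] -/
theorem comp_ne_zero_of_finrank_ker (L₁ : V₁ →ₗ[ℝ] V₂) (L₂ : V₂ →ₗ[ℝ] V₃)
    (h : Module.finrank ℝ (LinearMap.ker L₁) + Module.finrank ℝ (LinearMap.ker L₂) <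
      Module.finrank ℝ V₁) : L₂.comp L₁ ≠ 0 := by
  intro h0
  have hle : LinearMap.range L₁ ≤ LinearMap.ker L₂ := by
    rintro _ ⟨v, rfl⟩
    exact LinearMap.congr_fun h0 v
  have h1 := Submodule.finrank_mono hle
  have h2 := LinearMap.finrank_range_add_finrank_ker L₁
  omega

end LinearAlgebra

/-! ### Registered sub-goal -/

/-- **Registered sub-goal (explicit binders, universe `0`)**: the signed norm across a slice in
the model, `exists_signedNorm_model`. [folklore] -/
theorem stub_ballFunction_signedNormModel :
    ∀ (E : Type) [NormedAddCommGroup E] [NormedSpace ℝ E] [FiniteDimensional ℝ E]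
      (G : Type) [NormedAddCommGroup G] [InnerProductSpace ℝ G] [CompleteSpace G]
      (g : E × ℝ → G) (U : Set (E × ℝ)) (a₀ : E), IsOpen U → (a₀, (0 : ℝ)) ∈ U →
      ContDiffOn ℝ ∞ g U → (∀ a : E, (a, (0 : ℝ)) ∈ U → g (a, 0) = 0) →
      fderiv ℝ g (a₀, 0) (0, 1) ≠ 0 →
      ∃ (τ : E × ℝ → ℝ) (r : ℝ), 0 < r ∧ Metric.ball (a₀, (0 : ℝ)) r ⊆ U ∧
        ContDiffOn ℝ ∞ τ (Metric.ball (a₀, (0 : ℝ)) r) ∧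
        (∀ q ∈ Metric.ball (a₀, (0 : ℝ)) r, 0 ≤ q.2 → τ q = ‖g q‖) ∧
        (∀ q ∈ Metric.ball (a₀, (0 : ℝ)) r, q.2 ≤ 0 → τ q = -‖g q‖) ∧
        (∀ q ∈ Metric.ball (a₀, (0 : ℝ)) r, q.2 ≠ 0 → g q ≠ 0) ∧
        (∀ q ∈ Metric.ball (a₀, (0 : ℝ)) r, q.2 = 0 → fderiv ℝ τ q (0, 1) ≠ 0) :=
  fun _ _ _ _ _ _ _ _ _ _ _ hU ha₀ hg h0 hd => exists_signedNorm_model hU ha₀ hg h0 hd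

end Summit.SmoothPoincare4.SmoothPoincare4.Theorems.OrigamiRung.PairRigidityEndgame

end
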